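import Mathlib.Topology.Homotopy.Contractible
import Mathlib.AlgebraicTopology.FundamentalGroupoid.SimplyConnected
import Literature.Topology.FourManifolds.Gluing
import Literature.Topology.FourManifolds.Cobordism
import HarnessLib

/-!
# Corks and cork twists of smooth 4-manifolds

Topic `Literature/Topology/FourManifolds` (definition item `defn-IsCorkTwist`, route
`SmoothPoincare4/Stabilisation`).

A **cork** is a pair `(C, τ)` of a compact contractible smooth 4-manifold with boundary `C` and an
involution `τ` of `∂C` which extends to a self-homeomorphism of `C` but to no self-diffeomorphism
of `C` (Akbulut 1991; Akbulut–Yasui 2008, Def. 1.1, who in addition ask `C` to be Stein — a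
"loose cork" otherwise, Akbulut 2016, §10.1). If `C ⊂ X` is embedded in a smooth 4-manifold, the
**cork twist** of `X` along `(C, τ)` is `X' = (X ∖ int C) ∪_τ C`: remove `C` and reglue it by `τ`.
The cork theorem (Curtis–Freedman–Hsiang–Stong 1996; Matveyev 1996) says that any two
h-cobordant simply connected closed smooth 4-manifolds are related by a cork twist along a
compact contractible `C`.

Following the relational style of the four-manifold files (`Literature.Topology.FourManifolds.IsOpenGluing`,
`Literature.Topology.FourManifolds.IsBoundaryGluing`, `Literature.Topology.FourManifolds.IsGluckTwist`: no quotient types are built), we define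

* `Literature.IsCorkTwist bC τ IX X IX' X'` — *`X'` is obtained from `X` by the cork twist along
  `(C, τ)`*: there is a common "exterior" `W` (a charted space on the half-space model, with a
  boundary datum `bW`) and a boundary identification `φ : ∂C ≅ ∂W` such that
  `X = C ∪_φ W` and `X' = C ∪_{φ ∘ τ} W` (`Literature.Topology.FourManifolds.IsBoundaryGluing`). Here `W` plays the role of
  `X ∖ int C` — which cannot be carved out of `X` as a Mathlib manifold with boundary — and the
  embedding `C ↪ X` is the piece embedding of the first gluing. This is literally Matveyev's
  formulation "`M₁ = M ♯_Σ W₁`, `M₂ = M ♯_Σ W₂`" of the decomposition theorem.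
* The predicate "`(C, τ)` is a cork" is **not** defined here: it is `Literature.Topology.FourManifolds.IsCork` /
  `Literature.Topology.FourManifolds.IsLooseCork` of the sibling file `Corks.lean` (item `defn-IsCork`), typed over the same
  `BoundaryData (𝓡∂ 4) C (𝓡 3)`; this file only needs `τ` as a self-diffeomorphism of `∂C`.
* API: `IsCorkTwist.of_isBoundaryGluing` (constructor), `IsCorkTwist.symm` (twisting back by
  `τ⁻¹`), `IsCorkTwist.refl_of_isBoundaryGluing` (twisting by `id` changes nothing),
  `IsCorkTwist.compactSpace` (compact pieces give compact results).
* Named fact (statement only, D-0014): `Literature.Topology.FourManifolds.corkDecomposition` — Matveyev's Theorem /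
  CFHS: h-cobordant simply connected closed smooth 4-manifolds `X₁, X₂` admit a compact
  contractible `C` and a self-diffeomorphism `τ` of `∂C` with `IsCorkTwist bC τ X₁ X₂`.
  (That `τ` may moreover be taken to be an *involution*, and `C` Stein — Akbulut–Matveyev 1998 —
  is not vendored here.)

## Design choices

* `τ` and `φ` are `Diffeomorph`s of the boundary 3-manifolds (model `𝓡 3`), so that `φ ∘ τ` is
  again one (`τ.trans φ`); `IsBoundaryGluing` itself only uses the underlying functions.
* No `IsManifold`/`T2Space`/`CompactSpace` hypotheses are baked into `IsCorkTwist` (as for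
  `IsBoundaryGluing`, consumers add what they need).
* Universes: `C W : Type u` share the universe of `BoundaryData.carrier` (fixed by
  `Literature.Topology.FourManifolds.BoundaryData`); `X`, `X'` are universe polymorphic with arbitrary real models `IX`, `IX'`
  (as `IsGluckTwist`), the fact `corkDecomposition` is Euclidean (`𝓡 4`).
* Mathlib has manifolds with boundary (`𝓡∂ n`), `Diffeomorph`, `ContractibleSpace`,
  `SimplyConnectedSpace`, but no corks, cork twists or gluings (searched `cork`, `Cork`);
  gluing and boundary data are the library's `Literature.Topology.FourManifolds.IsBoundaryGluing`, `Literature.Topology.FourManifolds.BoundaryData`,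
  h-cobordism is `Literature.Topology.FourManifolds.IsHCobordant` (searched `IsCork`: only the concurrent `Corks.lean`).

## References

* S. Akbulut, *A fake compact contractible 4-manifold*, J. Differential Geom. 33 (1991) 335–356.
* C. L. Curtis, M. H. Freedman, W.-C. Hsiang, R. Stong, *A decomposition theorem for h-cobordant
  smooth simply-connected compact 4-manifolds*, Invent. Math. 123 (1996) 343–348.
* R. Matveyev, *A decomposition of smooth simply-connected h-cobordant 4-manifolds*,
  J. Differential Geom. 44 (1996) 571–582 (arXiv:dg-ga/9505001), Theorem (parts 1–2).
* S. Akbulut, K. Yasui, *Corks, plugs and exotic structures*, J. Gökova Geom. Topol. 2 (2008)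
  40–82, Def. 1.1.
* S. Akbulut, *4-Manifolds*, Oxford GTM 25 (2016), §10.1; R. Gompf, A. Stipsicz, *4-Manifolds and
  Kirby Calculus* (1999), §9.3.
-/

open scoped Manifold ContDiff Topology
open Set Function

noncomputable section

namespace Literature.Topology.FourManifolds

universe u

/-- Local notation: `𝔼 n` is the model Euclidean space `EuclideanSpace ℝ (Fin n)`. -/
local notation "𝔼 " n:arg => EuclideanSpace ℝ (Fin n)

section CorkTwist

variable {C : Type u} [TopologicalSpace C] [ChartedSpace (EuclideanHalfSpace 4) C]
  {EX HX EX' HX' : Type*} [NormedAddCommGroup EX] [NormedSpace ℝ EX] [TopologicalSpace HX]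
  [NormedAddCommGroup EX'] [NormedSpace ℝ EX'] [TopologicalSpace HX']

/-- **Cork twist** (relational form). `IsCorkTwist bC τ IX X IX' X'` says that the manifold `X'`
is obtained from the manifold `X` by *removing a copy of the 4-manifold with boundary `C` and
regluing it by the self-diffeomorphism `τ` of `∂C`*: there are a common exterior piece `W`
(a charted space on the half-space model `ℝ³ × [0, ∞)` with boundary datum `bW`, in every use
`W = X ∖ int C`) and a boundary identification `φ : ∂C ≅ ∂W` such that
`X = C ∪_φ W` and `X' = C ∪_{φ ∘ τ} W` as gluings along the boundary (`Literature.Topology.FourManifolds.IsBoundaryGluing`).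
The smooth embedding `C ↪ X` along which one twists is the piece embedding of the first gluing.
This is Matveyev's formulation `M₁ = M ♯_Σ W₁, M₂ = M ♯_Σ W₂` (with `W₁ ≅ W₂ ≅ C`, `M = W`).
[cite: Matveyev1996, Theorem] -/
def IsCorkTwist (bC : BoundaryData (𝓡∂ 4) C (𝓡 3))
    (τ : bC.carrier ≃ₘ⟮𝓡 3, 𝓡 3⟯ bC.carrier)
    (IX : ModelWithCorners ℝ EX HX) (X : Type*) [TopologicalSpace X] [ChartedSpace HX X]
    (IX' : ModelWithCorners ℝ EX' HX') (X' : Type*) [TopologicalSpace X'] [ChartedSpace HX' X'] :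
    Prop :=
  ∃ (W : Type u) (_ : TopologicalSpace W) (_ : ChartedSpace (EuclideanHalfSpace 4) W)
    (bW : BoundaryData (𝓡∂ 4) W (𝓡 3)) (φ : bC.carrier ≃ₘ⟮𝓡 3, 𝓡 3⟯ bW.carrier),
    IsBoundaryGluing bC bW φ IX X ∧ IsBoundaryGluing bC bW (τ.trans φ) IX' X'

variable {bC : BoundaryData (𝓡∂ 4) C (𝓡 3)} {τ : bC.carrier ≃ₘ⟮𝓡 3, 𝓡 3⟯ bC.carrier}
  {IX : ModelWithCorners ℝ EX HX} {X : Type*} [TopologicalSpace X] [ChartedSpace HX X]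
  {IX' : ModelWithCorners ℝ EX' HX'} {X' : Type*} [TopologicalSpace X'] [ChartedSpace HX' X']

/-- Constructor: if `X = C ∪_φ W` and `X' = C ∪_{φ ∘ τ} W` then `X'` is the cork twist of `X`
along `(C, τ)`. [cite: Matveyev1996, Theorem] -/
theorem IsCorkTwist.of_isBoundaryGluing {W : Type u} [TopologicalSpace W]
    [ChartedSpace (EuclideanHalfSpace 4) W] (bW : BoundaryData (𝓡∂ 4) W (𝓡 3))
    (φ : bC.carrier ≃ₘ⟮𝓡 3, 𝓡 3⟯ bW.carrier) (hX : IsBoundaryGluing bC bW φ IX X)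
    (hX' : IsBoundaryGluing bC bW (τ.trans φ) IX' X') : IsCorkTwist bC τ IX X IX' X' :=
  ⟨W, _, _, bW, φ, hX, hX'⟩

/-- `IsBoundaryGluing` depends only on the underlying function of the gluing map. [folklore] -/
theorem isBoundaryGluing_congr {W : Type u} [TopologicalSpace W]
    [ChartedSpace (EuclideanHalfSpace 4) W] {bW : BoundaryData (𝓡∂ 4) W (𝓡 3)}
    {φ ψ : bC.carrier → bW.carrier} (hφψ : ∀ z, φ z = ψ z) {EP HP : Type*}
    [NormedAddCommGroup EP] [NormedSpace ℝ EP] [TopologicalSpace HP] {IP : ModelWithCorners ℝ EP HP}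
    {P : Type*} [TopologicalSpace P] [ChartedSpace HP P] (h : IsBoundaryGluing bC bW φ IP P) :
    IsBoundaryGluing bC bW ψ IP P :=
  IsClosedGluing.congr h fun a b => by simp only [hφψ]

/-- **Twisting back.** If `X'` is the cork twist of `X` along `(C, τ)` then `X` is the cork twist
of `X'` along `(C, τ⁻¹)` (same exterior `W`, boundary identification `φ ∘ τ`); for a cork
`τ⁻¹ = τ`. [cite: Matveyev1996, Theorem] -/
theorem IsCorkTwist.symm (h : IsCorkTwist bC τ IX X IX' X') : IsCorkTwist bC τ.symm IX' X' IX X := by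
  obtain ⟨W, _, _, bW, φ, hX, hX'⟩ := h
  refine ⟨W, _, _, bW, τ.trans φ, hX', isBoundaryGluing_congr (fun z => ?_) hX⟩
  simp

/-- For an involutive `τ` (e.g. a cork), the cork-twist relation is symmetric in `X`, `X'`.
[cite: Matveyev1996, Theorem] -/
theorem IsCorkTwist.symm_of_involutive (hτ : Function.Involutive τ)
    (h : IsCorkTwist bC τ IX X IX' X') : IsCorkTwist bC τ IX' X' IX X := by
  obtain ⟨W, _, _, bW, φ, hX, hX'⟩ := h
  refine ⟨W, _, _, bW, τ.trans φ, hX', isBoundaryGluing_congr (fun z => ?_) hX⟩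
  simp [hτ z]

/-- Twisting by the identity changes nothing: if `X = C ∪_φ W` then `X` is the cork twist of
itself along `(C, id)`. [cite: Matveyev1996, Theorem] -/
theorem IsCorkTwist.refl_of_isBoundaryGluing {W : Type u} [TopologicalSpace W]
    [ChartedSpace (EuclideanHalfSpace 4) W] (bW : BoundaryData (𝓡∂ 4) W (𝓡 3))
    (φ : bC.carrier ≃ₘ⟮𝓡 3, 𝓡 3⟯ bW.carrier) (hX : IsBoundaryGluing bC bW φ IX X) :
    IsCorkTwist bC (Diffeomorph.refl (𝓡 3) bC.carrier ∞) IX X IX X :=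
  ⟨W, _, _, bW, φ, hX, isBoundaryGluing_congr (fun z => by simp) hX⟩

/-- A cork twist of anything along a compact `C` with compact exterior is compact; in the
relational form: if `X'` is a cork twist of `X` along `(C, τ)` with `C` compact and the exterior
of the witnessing decomposition compact, `X'` is compact. Stated with the exterior exposed.
[folklore] -/
theorem IsCorkTwist.compactSpace_of_isBoundaryGluing [CompactSpace C] {W : Type u}
    [TopologicalSpace W] [ChartedSpace (EuclideanHalfSpace 4) W] [CompactSpace W]
    (bW : BoundaryData (𝓡∂ 4) W (𝓡 3)) (φ : bC.carrier ≃ₘ⟮𝓡 3, 𝓡 3⟯ bW.carrier)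
    (hX' : IsBoundaryGluing bC bW (τ.trans φ) IX' X') : CompactSpace X' :=
  hX'.compactSpace

end CorkTwist

/-! ### The cork theorem (statement; D-0014) -/

/-- **Cork decomposition theorem** (Matveyev 1996, Theorem; Curtis–Freedman–Hsiang–Stong 1996).
If `X₁`, `X₂` are h-cobordant simply connected closed smooth 4-manifolds, then there are a
compact contractible smooth 4-manifold with boundary `C` and a self-diffeomorphism `τ` of `∂C`
such that `X₂` is the cork twist of `X₁` along `(C, τ)`: `X₁ = C ∪_φ W`, `X₂ = C ∪_{φ∘τ} W` for a
common exterior `W` (Matveyev: "`M₁ = M ♯_Σ W₁`, `M₂ = M ♯_Σ W₂` with `W₁, W₂` smooth compact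
contractible and `W₁` diffeomorphic to `W₂`"). The refinements that `τ` can be chosen to be an
involution and `C` Stein (Akbulut–Matveyev 1998), and the compatibility with `H₂`, are not part
of this statement. By Wall and Freedman, "h-cobordant" may be replaced by "homeomorphic" for
simply connected closed smooth 4-manifolds (not used here). [cite: Matveyev1996, Theorem] -/
def corkDecomposition : Prop :=
  ∀ (X₁ X₂ : Type u) [TopologicalSpace X₁] [T2Space X₁] [SecondCountableTopology X₁]
    [ChartedSpace (𝔼 4) X₁] [IsManifold (𝓡 4) ∞ X₁] [CompactSpace X₁] [SimplyConnectedSpace X₁]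
    [TopologicalSpace X₂] [T2Space X₂] [SecondCountableTopology X₂]
    [ChartedSpace (𝔼 4) X₂] [IsManifold (𝓡 4) ∞ X₂] [CompactSpace X₂] [SimplyConnectedSpace X₂],
    IsHCobordant 4 X₁ X₂ →
      ∃ (C : Type u) (_ : TopologicalSpace C) (_ : T2Space C) (_ : SecondCountableTopology C)
        (_ : ChartedSpace (EuclideanHalfSpace 4) C) (_ : IsManifold (𝓡∂ 4) ∞ C)
        (bC : BoundaryData (𝓡∂ 4) C (𝓡 3)) (τ : bC.carrier ≃ₘ⟮𝓡 3, 𝓡 3⟯ bC.carrier),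
        CompactSpace C ∧ ContractibleSpace C ∧ IsCorkTwist bC τ (𝓡 4) X₁ (𝓡 4) X₂

end Literature.Topology.FourManifolds

end
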